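import Summits.ResolutionOfSingularities.ResolutionOfSingularities.Theorems.WeightedInvariantELadderTwoStepOff
import Summits.ResolutionOfSingularities.ResolutionOfSingularities.Theorems.WeightedInvariantELadderTwoInducedAtlasLift
import Summits.ResolutionOfSingularities.ResolutionOfSingularities.Theorems.WeightedInvariantELadderTwoAtlasReadingsBelow
import Summits.ResolutionOfSingularities.ResolutionOfSingularities.Theorems.WeightedInvariantELadderTwoMaxClosed
import HarnessLib

/-!
# Rung `e = 2`: the E2 STEP `stub_e2_step_h` rests on the over-centre reading (S-b2-over') alone

Cell `res-hironaka`, line `L W4.3`, door crux `HypersurfaceCentreConstruction` (stmt-ResolutionOfSingularities-19897),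
E2 tier; registrar res-L1-w43-plan-1, SPEC (Δ6b)/(Δ9) (`E2Step_split_sketch.lean` rev 9 953f5c5330827eca, glue
`stub_e2_step_h_of_fiveCover'`); E2 assembler res-D-pv-031 (DEALER 19:27:40Z (2c)).  OURS bookkeeping; nothing here is a
statement of [Hironaka2017]; AI-written, weaker than expert review.

Of the five hands of the registrar's `stub_e2_step_h_of_fiveCover'`, four are tree theorems:
(S-a) `LocalEngine.e2StepOffBody` (…ELadderTwoStepOff, res-L1-s36-pv-2), (S-b1') `LocalEngine.e2InducedAtlas_cover_lift`
(…ELadderTwoInducedAtlasLift, res-D-pv-048; the registrar's `E2InducedAtlasCoverBody_of_cover` is the projection used below),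
(S-b2-below') `LocalEngine.e2AtlasReadingsBelow` (…ELadderTwoAtlasReadingsBelow, res-D-pv-048), and (S-c) = the shared (C-b)
`LocalEngine.e2MaxClosed` under the graded HOM rung (…ELadderTwoMaxClosed, res-D-pv-031; the registrar's
`E2StepMaxBody_of_maxClosed` read through `IsCanonicalCentre₂.support_eq`).  Hence, DEF-FREE:

* `stub_e2_step_h_of_over` — **`(∀ p, p.Prime → <E2AtlasOverCentreBody p>) → ∀ p, p.Prime → ∀ ι J, PRungGrHomLE 3 p ι J → E2StepBody p ι J`**,
  i.e. the registered `stub_e2_step_h` BY ITS STATEMENT from the single hypothesis (S-b2-over'), stated with the registrar's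
  `E2AtlasOverCentreBody p` spelled out binder for binder (its `InducedAlongCover S R R' Dg ρ 𝒜'` clause spelled out exactly as in
  the hypothesis of `e2AtlasReadingsBelow`, = the conclusion of `e2InducedAtlas_cover_lift` after its atlas binder) — the shape
  res-L1-s36-pv-2's `LocalEngine.e2AtlasOverCentre (p)` ((o59-b2-over), …ELadderTwoAtlasOverCentre) is announced to have, so that
  `stub_e2_step_h_of_over (fun p _ => e2AtlasOverCentre p)` closes the stub.
-/

noncomputable section

set_option linter.dupNamespace false -- mandated namespace of this single-conjunct summit

open CategoryTheory AlgebraicGeometry TopologicalSpace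
open Literature.AlgebraicGeometry.Resolution
open Summit.ResolutionOfSingularities.ResolutionOfSingularities.Theorems

namespace Summit.ResolutionOfSingularities.ResolutionOfSingularities.Cruxes.HypersurfaceCentreConstruction.LocalEngine

open Summit.ResolutionOfSingularities.ResolutionOfSingularities.Theorems.ELadderOne

/-- **`stub_e2_step_h` BY ITS STATEMENT from the single hypothesis (S-b2-over')** (`E2AtlasOverCentreBody p` of SPEC (Δ6b)
rev 6+, spelled out): for a non-regular (I0)₂ stage, an admissible CANONICAL centre `R` with the generic point of `X` off the
support and its Rees filtration `R'`, the successor presentation `(V', ρ, q', σ_X, 𝒜')` of `e2InducedAtlas_cover_lift` is a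
COMPATIBLE successor: (I0)₂ and «read points over read points» by `e2AtlasReadingsBelow`; over the support the read point
below is a maximum point by (C-b) `e2MaxClosed` (`supp R = closure (maxLocus₂ ι)`) and the cobordant model is the hypothesis;
off the support the torus-factor model is `e2StepOffBody`. [OURS] -/
theorem stub_e2_step_h_of_over
    (hover : ∀ p : ℕ, p.Prime →
      ∀ ⦃k : Type⦄ [Field k] [CharP k p] [PerfectField k] (S : Stage k), S.InvDim₂ → ¬ Scheme.IsRegular S.X →
        ∀ (R : ReesAlgebraData S.Y), IsAdmissibleCentre S.f S.i.ker R → S.i (genericPoint S.X) ∉ R.support →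
          ∀ (R' : ReesFiltration S.Y), R'.ideal = R.piece →
        ∀ [Smooth (R'.πPlus ≫ S.f)] [IsSeparated (R'.πPlus ≫ S.f)] [QuasiCompact (R'.πPlus ≫ S.f)]
          [IsIntegral (R'.strictTransformPlus S.i.ker).subscheme]
          (hlp' : IsLocallyPrincipal (R'.strictTransformPlus S.i.ker).subschemeι.ker)
          (Dg : ℕ) (_ : 0 < Dg)
          (V' : Scheme.{0}) (ρ : V' ⟶ S.V) [IsIntegral V'] [IsProper ρ]
          (_ : IsBlowup ρ ((((R.piece Dg).comap S.i).subschemeι ≫ S.q).ker))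
          (q' : (R'.strictTransformPlus S.i.ker).subscheme ⟶ V')
          (hq' : q' ≫ ρ ≫ S.g = (R'.strictTransformPlus S.i.ker).subschemeι ≫ R'.πPlus ≫ S.f)
          (σX : (R'.strictTransformPlus S.i.ker).subscheme ⟶ S.X)
          (_ : σX ≫ S.i = (R'.strictTransformPlus S.i.ker).subschemeι ≫ R'.πPlus) (_ : q' ≫ ρ = σX ≫ S.q)
          (𝒜' : GradedAtlas (S.j + 1) (R'.πPlus ≫ S.f) (R'.strictTransformPlus S.i.ker).subschemeι q'),
        (∃ (oc : 𝒜'.ι → S.atlas.ι)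
            (hle : ∀ a' : 𝒜'.ι,
              (𝒜'.W a' : (R'.plus : Scheme.{0}).Opens) ≤ R'.πPlus ⁻¹ᵁ (S.atlas.W (oc a') : S.Y.Opens)),
            𝒜'.exponent = S.atlas.exponent * Dg ∧
            (∀ (x' : ↥(R'.strictTransformPlus S.i.ker).subscheme) (a : S.atlas.ι),
              R'.πPlus.base ((R'.strictTransformPlus S.i.ker).subschemeι.base x') ∈ (S.atlas.W a : S.Y.Opens) →
              ∃ a' : 𝒜'.ι, oc a' = a ∧
                (R'.strictTransformPlus S.i.ker).subschemeι.base x' ∈ (𝒜'.W a' : (R'.plus : Scheme.{0}).Opens)) ∧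
            (∀ (a' : 𝒜'.ι) (e : ℕ),
              (∀ χ : Fin S.j → ℤ, ∃ s ∈ S.atlas.piece (oc a') (e • χ), IsUnit (S.i.app (S.atlas.W (oc a')) s)) →
              ∀ χ' : Fin (S.j + 1) → ℤ, ∃ s' ∈ 𝒜'.piece a' ((e * Dg) • χ'),
                IsUnit ((R'.strictTransformPlus S.i.ker).subschemeι.app (𝒜'.W a') s')) ∧
            ∀ a' : 𝒜'.ι,
              (∀ (χ : Fin S.j → ℤ) (s : Γ(S.Y, S.atlas.W (oc a'))), s ∈ S.atlas.piece (oc a') χ →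
                R'.πPlus.appLE (S.atlas.W (oc a')) (𝒜'.W a') (hle a') s ∈
                  𝒜'.piece a' (Fin.snoc (α := fun _ => ℤ) χ 0)) ∧
              tInvOn R' (𝒜'.W a') ∈ 𝒜'.piece a' (Fin.snoc (α := fun _ => ℤ) 0 (-1)) ∧
              ∃ (β : Γ(S.Y, S.atlas.W (oc a'))) (η : Γ((R'.plus : Scheme.{0}), 𝒜'.W a')),
                β ∈ (R.piece Dg).ideal (S.atlas.W (oc a')) ∧ β ∈ S.atlas.piece (oc a') 0 ∧ IsUnit η ∧
                η ∈ 𝒜'.piece a' (Fin.snoc (α := fun _ => ℤ) 0 (Dg : ℤ)) ∧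
                η * tInvOn R' (𝒜'.W a') ^ Dg = R'.πPlus.appLE (S.atlas.W (oc a')) (𝒜'.W a') (hle a') β ∧
                (∀ y' : (R'.plus : Scheme.{0}), y' ∈ (𝒜'.W a' : (R'.plus : Scheme.{0}).Opens) ↔
                  ∃ (O : (R'.plus : Scheme.{0}).affineOpens)
                    (hO : (O : (R'.plus : Scheme.{0}).Opens) ≤ R'.πPlus ⁻¹ᵁ (S.atlas.W (oc a') : S.Y.Opens)),
                    y' ∈ (O : (R'.plus : Scheme.{0}).Opens) ∧ ∃ η₀ : Γ((R'.plus : Scheme.{0}), O),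
                      IsUnit η₀ ∧ η₀ * tInvOn R' O ^ Dg = R'.πPlus.appLE (S.atlas.W (oc a')) O hO β) ∧
                (∀ s ∈ 𝒜'.piece a' 0, ∃ (l : ℕ) (x : Γ(S.Y, S.atlas.W (oc a'))),
                  x ∈ (R.piece (Dg * l)).ideal (S.atlas.W (oc a')) ∧ x ∈ S.atlas.piece (oc a') 0 ∧
                    s * η ^ l * tInvOn R' (𝒜'.W a') ^ (Dg * l) =
                      R'.πPlus.appLE (S.atlas.W (oc a')) (𝒜'.W a') (hle a') x) ∧
                (∀ (l : ℕ) (x : Γ(S.Y, S.atlas.W (oc a'))), x ∈ (R.piece (Dg * l)).ideal (S.atlas.W (oc a')) →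
                  x ∈ S.atlas.piece (oc a') 0 → ∃ s ∈ 𝒜'.piece a' 0,
                    s * η ^ l * tInvOn R' (𝒜'.W a') ^ (Dg * l) =
                      R'.πPlus.appLE (S.atlas.W (oc a')) (𝒜'.W a') (hle a') x) ∧
                (∀ x : Γ(S.Y, S.atlas.W (oc a')), R'.πPlus.appLE (S.atlas.W (oc a')) (𝒜'.W a') (hle a') x ∈
                  (R'.strictTransformPlus S.i.ker).ideal (𝒜'.W a') → x * β ∈ S.i.ker.ideal (S.atlas.W (oc a'))) ∧
                ∃ b : Γ(S.V, S.atlas.U (oc a')),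
                  b ∈ ((((R.piece Dg).comap S.i).subschemeι ≫ S.q).ker).ideal (S.atlas.U (oc a')) ∧
                  S.i.app (S.atlas.W (oc a')) β =
                    S.q.appLE (S.atlas.U (oc a')) (S.i ⁻¹ᵁ (S.atlas.W (oc a'))) (S.atlas.preimage_eq (oc a')).le b ∧
                  (𝒜'.U a' : V'.Opens) =
                    blowupChart ρ ((((R.piece Dg).comap S.i).subschemeι ≫ S.q).ker) (S.atlas.U (oc a')) b) →
          (Stage.InvDim₂ (⟨R'.plus, R'.πPlus ≫ S.f, (R'.strictTransformPlus S.i.ker).subscheme,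
              (R'.strictTransformPlus S.i.ker).subschemeι, hlp', V', q', ρ ≫ S.g, hq', S.j + 1, 𝒜'⟩ : Stage k) ∧
            ∀ η' ∈ Stage.genSing₂ (⟨R'.plus, R'.πPlus ≫ S.f, (R'.strictTransformPlus S.i.ker).subscheme,
              (R'.strictTransformPlus S.i.ker).subschemeι, hlp', V', q', ρ ≫ S.g, hq', S.j + 1, 𝒜'⟩ : Stage k),
              R'.πPlus.base η' ∈ S.genSing₂) →
          ∀ η' ∈ Stage.genSing₂ (⟨R'.plus, R'.πPlus ≫ S.f, (R'.strictTransformPlus S.i.ker).subscheme,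
              (R'.strictTransformPlus S.i.ker).subschemeι, hlp', V', q', ρ ≫ S.g, hq', S.j + 1, 𝒜'⟩ : Stage k),
            R'.πPlus.base η' ∈ R.support →
              S.SuccOverCentreAt R ⟨R'.plus, R'.πPlus ≫ S.f, (R'.strictTransformPlus S.i.ker).subscheme,
              (R'.strictTransformPlus S.i.ker).subschemeι, hlp', V', q', ρ ≫ S.g, hq', S.j + 1, 𝒜'⟩ R'.πPlus η')
    : ∀ p : ℕ, p.Prime → ∀ (ι : (R : Type) → [CommRing R] → R → Ordinal.{0})
      (J : (R : Type) → [CommRing R] → R → ℕ → Ideal R), PRungGrHomLE 3 p ι J → E2StepBody p ι J := by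
  intro p hp ι J hr k _ _ _ S hI hreg R hadm hξ hcan R' hR' _ _ _ _ hlp'
  -- (S-b1'): the induced successor presentation with cover, lift `σ_X` and `q' ≫ ρ = σ_X ≫ q`
  obtain ⟨Dg, hDg, V', ρ, hV', hρ, hbl, q', hq', σX, hσX, hρq, 𝒜', hind⟩ :=
    e2InducedAtlas_cover_lift S R hadm hξ R' hR'
  haveI := hV'
  haveI := hρ
  -- (S-b2-below'): (I0)₂ of the successor and read points over read points
  have hbelow := e2AtlasReadingsBelow p S hI hreg R hadm hξ R' hR' hlp' Dg hDg V' ρ hbl q' hq' σX hσX hρq 𝒜' hind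
  refine ⟨V', ρ, hV', hρ, q', hq', 𝒜', hbelow.1, fun η' hη' hsupp => ⟨?_, ?_⟩, fun η' hη' hsupp =>
    ⟨hbelow.2 η' hη', e2StepOffBody p S R hadm R' hR' hlp' V' ρ q' hq' 𝒜' η' hsupp⟩⟩
  · -- (S-c) via (C-b): the read point below lies in `supp R = closure (maxLocus₂ ι)`, hence in `maxLocus₂ ι`
    have hy : R'.πPlus.base η' ∈ S.genSing₂ := hbelow.2 η' hη'
    rw [hcan.support_eq] at hsupp
    exact e2MaxClosed p ι J hr S hI hreg _ hy hsupp
  · -- (S-b2-over'): the cobordant local model over the support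
    exact hover p hp S hI hreg R hadm hξ R' hR' hlp' Dg hDg V' ρ hbl q' hq' σX hσX hρq 𝒜' hind hbelow η' hη' hsupp

end Summit.ResolutionOfSingularities.ResolutionOfSingularities.Cruxes.HypersurfaceCentreConstruction.LocalEngine

end
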